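import Summits.ABC.IUTFork.Cor312PilotIdelesMReadBad
import Summits.ABC.IUTFork.Cor312PilotIdelesMReadSupport
import Summits.ABC.IUTFork.Conditional.HexBadPlacesOverDeepPrime
import Summits.ABC.IUTFork.Conditional.AbcOfSHvolSplitHeight
import Literature.IUT.LogVolume.Corollary22LegendreDeepAdmissiblePairs
import Literature.IUT.LogVolume.Corollary22TwoAdicIntegrality
import Literature.IUT.LogVolume.DepthConstantsBound
import Literature.IUT.LogVolume.LocalDegreeBridge
import HarnessLib

/-!
# The READ-OFF q-idele `t_{q,v̲}` of a genuine Θ-volume datum at the M-level presentation: its norm at a bad member is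
# `p^{ord_v(j_E)/(2l·e_v)}`, for a RATIONAL `j`-invariant `p^{ord_p(j)/(2l)}`; the packet constants of `K_{v̲}` are bounded by
# `[K : ℚ]`; and every member over a deep prime of `λ` is BAD (bricks (H2)–(H4), (H6) of «HEX-KERNEL» at the M level)

PROOF-ONLY support piece (D-0012; 0 definitions, 0 `Prop` facts) of the abc-iut cell (WAVE-5 discharge seat abc-iut-w5-d166, gen 5; unit
«DEEP-M» / «HEX-M»: the M-level twin of abc-iut-w4-d026's `Cor312ProvKChosenQIdeleNorm` (p442760), abc-iut-C-cert-1's §1 of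
`Conditional/AbcOfSGenuineKChosenDepthDegree` (p440189) and abc-iut-w4-d098's `Conditional/HexBadPlacesOverDeepPrime` (p442895)). TAKES NO
SIDE on [IUTchIII] Cor. 3.12 or on any author; classical valuation bookkeeping on OUR typed objects (abc-iut-w5-d166's M-level presentation
`presAtM` / `kOfM` / `placeOfM` / `placeModOfM`, abc-iut-w5-d033's read-off ideles `tqM D p u hu r x`).

WHY. The residual input `hex` of `Conditional.not_hSH_v10M_of_exists_deep` (this seat, p444095) asks for an admissible `(P, l)`, a datum `T`,
a finite place `u` of `ℚ`, a label and a member `x₀ ∈ V̲_u` of the M-fibre at which `p_u^{(j+1)(d+a+b)+1}·‖t_{q,x₀}‖^{j²−1} < 1` with the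
packet constants `d, a, b` ([IUTchIV] Prop. 1.2) of `K₀ = K_{v̲(x₀)} = kOfM …`. Exactly as for the K line (HEX-KERNEL (H5), p443047-family),
this follows at the tree's witness family `λ_k = 1/2 + 2/7^k` from: `d + a + b < 4 + 2·log_p [K : ℚ]` (this file, §1), `‖t_{q,x₀}‖ ≤ 7^{−k/l}`
at every member over `7` (§3–§4), and the arithmetic core `Hex.core_ineq`.

WHAT IS PROVED (namespace `Summit.ABC.IUTFork.Thm311.Real`; `D : InitialThetaData F K F̄ E l Pb`, `u` a finite place of `ℚ` containing `p`,
`x` a member of the fibre `V̲_u`, `v := placeModOfM D u x` the place of `F_mod` under it, `w := placeOfM D u x` the section place of `K`):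
* §1 `finrank_kOfM_le` — `[K_{v̲} : ℚ_p] ≤ [K : ℚ]`; `depthConstants_kOfM_lt` — `d + a + b < 4 + 2·log_p [K : ℚ]` (`p > 2`; campaign-S
  `depthConstants_lt`).
* §2 `norm_tqM_eq_rpow_ord_jMod` — at a BAD member (`v ∈ S = V^bad_mod`): `‖t_{q,x}‖ = p^{ord_v(j_E)/(2l·e_v)}` (`ord_v(j_E) < 0`, `e_v = e(v|p)` the
  absolute ramification index of `F_mod` at `v`): abc-iut-w5-d033's Dupuy–Hilado (3.4) identity `log_norm_tqM` with `P_q(v) = ord_v(q)/(2l)`,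
  `ord_v(q) = −ord_v(j_E)` and `ln|κ(v)|/n_v = ln p/e_v`; `norm_tqM_lt_one`.
* §3 RATIONAL `j`-invariant (`E.j = j₀ ∈ ℚ`, the `λ`-line data of [IUTchIV] Cor. 2.2): `jMod_eq_ratCast` (`j_E = j₀` in `F_mod`),
  `norm_tqM_eq_rpow_ord_rat` — `‖t_{q,x}‖ = p^{ord_p(j₀)/(2l)}`: NO ramification index of the opaque fields remains (`ord_v(j₀) = e(v|p)·ord_p(j₀)`,
  `e_v = e(v|p)·ord_p(p)`, `ord_p(p) = 1`); `norm_tqM_le_rpow_of_ord_le` — `ord_p(j₀) ≤ −h ⟹ ‖t_{q,x}‖ ≤ p^{−h/(2l)}`.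
* §4 WHICH members are bad ((H6) at the M level): `placeModOfM_mem_S_of_ord_j_neg` — for a datum whose `𝕍^bad_mod` is the (P5) choice, a member
  `x` with `p ≠ 2, l` and `ord j(E_F) < 0` at the place of `F` under `w` is bad (abc-iut-w4-d098 `Hex.mem_pilotDataOfK_S_of_residueChar` at the
  section place + `ThetaData.mk_mem_VFbad_iff`); `placeModOfM_mem_S_and_norm_tqM_le_of_ratPoint` — the (H4)+(H6) package at `P = ratPoint λ`:
  a pole of `j(λ)` of order `≥ h ≥ 1` at `p ≠ 2, l` makes EVERY member of `V̲_u` bad with `‖t_{q,x}‖ ≤ p^{−h/(2l)}`.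
HONEST SCOPE: bookkeeping only; nothing here decides any reading of [IUTchIII] Cor. 3.12; typed ≠ proved; instantiated ≠ endorsed.
[cite: DupuyHilado2025, §3.3, §3.4] [cite: Mochizuki2012, IUTchI Def. 3.1 (b)(e) p. 61–62; IUTchIV Prop. 1.2 p. 10, Cor. 2.2 (ii) proof (P5) p. 46]
[cite: NeukirchANT1999, Ch. I (8.2), Ch. II Prop. (8.5)]
-/

noncomputable section

open Set Function NumberField IsDedekindDomain

namespace Summit.ABC.IUTFork.Thm311.Real

open Cor312Vol Cor312Prov Literature.IUT.LogThetaLattice Literature.IUT.LogVolume Literature.IUT.HodgeTheaters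
  Literature.NumberTheory.NumberFields Literature.NumberTheory.DiophantineGeometry
  Literature.NumberTheory.DiophantineGeometry.GenEll

variable {F K Fbar : Type} [Field F] [NumberField F] [Field K] [NumberField K] [Algebra F K]
  [Field Fbar] [Algebra F Fbar] [Algebra K Fbar] {E : WeierstrassCurve F} [E.IsElliptic] {l : ℕ}
  {Pb : BadPlacePredicates K} (D : InitialThetaData F K Fbar E l Pb)
  (p : ℕ) [hp : Fact p.Prime] (u : FinitePlace ℚ) (hu : ((p : ℕ) : 𝓞 ℚ) ∈ (FinitePlace.maximalIdeal u).asIdeal)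

/-! ## §1. The packet constants of `K_{v̲}` are bounded by the global degree `[K : ℚ]` -/

include hu in
/-- **`[K_{v̲} : ℚ_p] ≤ [K : ℚ]`** for the genuine completion `kOfM D p u hu x` at a member of the fibre (`[K_w : ℚ_p] = n_w`,
`RescaledCompletion.localDeg_eq_finrank`, `≤ Σ_{w | p} n_w = [K : ℚ]`, `sum_localDeg`). M-level twin of `finrank_kOf_le`.
[cite: NeukirchANT1999, Ch. II Prop. (8.5)] -/
theorem finrank_kOfM_le (x : (thetaIndexOfInitial D).Fibre (Val.non u)) :
    Module.finrank ℚ_[p] (kOfM D p u hu x) ≤ Module.finrank ℚ K := by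
  have h1 : Module.finrank ℚ_[p] (kOfM D p u hu x) = localDeg K (placeOfM D u x) :=
    (RescaledCompletion.localDeg_eq_finrank K p (placeOfM D u x) (natCast_mem_placeOfM D p u hu x)).symm
  rw [h1, ← sum_localDeg K p]
  exact Finset.single_le_sum (fun v _ => Nat.zero_le (localDeg K v)) (placeOfM_mem_placesOver D p u hu x)

include hu in
/-- **`d + a + b < 4 + 2·log_p [K : ℚ]`** for the [IUTchIV] Prop. 1.2 constants of `K_{v̲} = kOfM D p u hu x`, `p > 2` (campaign-S
`depthConstants_lt` + `finrank_kOfM_le`). M-level twin of `depthConstants_kOf_lt`. [cite: Mochizuki2012, IUTchIV Prop. 1.2 p. 10, Prop. 1.3 p. 12] -/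
theorem depthConstants_kOfM_lt (hp2 : 2 < p) (x : (thetaIndexOfInitial D).Fibre (Val.non u)) :
    differentOrd p (kOfM D p u hu x) + logRadiusA p (absRamificationIdx p (kOfM D p u hu x))
        + logRadiusB p (absRamificationIdx p (kOfM D p u hu x)) <
      4 + 2 * Real.logb p (Module.finrank ℚ K) := by
  have h := depthConstants_lt p (kOfM D p u hu x) hp2
  have hpR : (1 : ℝ) < (p : ℝ) := by exact_mod_cast hp.out.one_lt
  have hn1 : (1 : ℝ) ≤ (Module.finrank ℚ_[p] (kOfM D p u hu x) : ℝ) := by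
    have h1 : 1 ≤ Module.finrank ℚ_[p] (kOfM D p u hu x) :=
      (absRamificationIdx_pos p (kOfM D p u hu x)).trans_le (absRamificationIdx_le_finrank p (kOfM D p u hu x))
    exact_mod_cast h1
  have hle : Real.logb p (Module.finrank ℚ_[p] (kOfM D p u hu x)) ≤ Real.logb p (Module.finrank ℚ K) :=
    Real.logb_le_logb_of_le hpR (by linarith) (by exact_mod_cast finrank_kOfM_le D p u hu x)
  linarith

/-! ## §2. The read-off q-idele at a BAD member: `‖t_{q,x}‖ = p^{ord_v(j_E)/(2l·e_v)} < 1` -/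

section Ideles

variable (r : ThetaData.IdeleData D)

/-- **`‖t_{q,x}‖ = p^{ord_v(j_E)/(2l·e_v)}` at a BAD member** (`v = placeModOfM D u x ∈ S = V^bad_mod`; `ord_v(j_E) < 0`, `e_v` the absolute
ramification index of `F_mod` at `v`): Dupuy–Hilado (3.4) (`log_norm_tqM`) with `P_q(v) = ord_v(q)/(2l)`, `ord_v(q) = −ord_v(j_E)` and
`ln|κ(v)|/n_v = ln p/e_v`. M-level twin of abc-iut-w4-d026's `norm_chosenQIdele_eq_rpow_ord_jE`. [cite: DupuyHilado2025, §3.3, §3.4] -/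
theorem norm_tqM_eq_rpow_ord_jMod (x : (thetaIndexOfInitial D).Fibre (Val.non u))
    (hx : placeModOfM D u x ∈ (ThetaData.pilotData D).S) :
    ‖tqM D p u hu r x‖ =
      (p : ℝ) ^ ((ord (fieldOfModuli E) (placeModOfM D u x) (ThetaData.jMod E) : ℝ) /
        (2 * l * ramIdx (fieldOfModuli E) (placeModOfM D u x))) := by
  have hq0 : 0 < ‖tqM D p u hu r x‖ := norm_pos_iff.mpr (tqM_ne_zero D p u hu r x)
  have hp0 : (0 : ℝ) < (p : ℝ) := by exact_mod_cast hp.out.pos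
  have h := log_norm_tqM D p u hu r x
  rw [PilotData.qPilot_apply_of_mem (ThetaData.pilotData D) hx, mul_div_assoc, logNorm_div_localDegree_eq_log_div_ramIdx,
    residueChar_placeModOfM D p u hu x] at h
  rw [← Real.exp_log hq0, h, Real.rpow_def_of_pos hp0]
  congr 1
  unfold PilotData.ordq
  rw [ThetaData.pilotData_jE, ThetaData.pilotData_l]
  push_cast
  ring

/-- **`‖t_{q,x}‖ < 1` at a bad member** (`ord_v(j_E) < 0`, `e_v ≥ 1`). [cite: DupuyHilado2025, §3.3, §3.4] -/
theorem norm_tqM_lt_one (x : (thetaIndexOfInitial D).Fibre (Val.non u)) (hx : placeModOfM D u x ∈ (ThetaData.pilotData D).S) :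
    ‖tqM D p u hu r x‖ < 1 := by
  have hp1 : (1 : ℝ) < (p : ℝ) := by exact_mod_cast hp.out.one_lt
  have hl : 0 < l := lt_of_lt_of_le (by norm_num) D.five_le_l
  have he : 0 < ramIdx (fieldOfModuli E) (placeModOfM D u x) := Nat.pos_of_ne_zero (ramIdx_ne_zero _ _)
  have hj : ord (fieldOfModuli E) (placeModOfM D u x) (ThetaData.jMod E) < 0 := by
    have h := (ThetaData.pilotData D).ord_jE_neg _ hx
    rwa [ThetaData.pilotData_jE] at h
  rw [norm_tqM_eq_rpow_ord_jMod D p u hu r x hx]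
  refine Real.rpow_lt_one_of_one_lt_of_neg hp1 (div_neg_of_neg_of_pos (by exact_mod_cast hj) ?_)
  have : (0 : ℝ) < (l : ℝ) := by exact_mod_cast hl
  have : (0 : ℝ) < (ramIdx (fieldOfModuli E) (placeModOfM D u x) : ℝ) := by exact_mod_cast he
  positivity

/-! ## §3. Rational `j`-invariant: the ramification CANCELS -/

omit hp in
/-- `j_E = j₀` in `F_mod` when `E.j = j₀ ∈ ℚ` in `F` (`F_mod = ℚ(j_E) ⊆ F`). [cite: Mochizuki2012, IUTchI Def. 3.1 (b) p. 61] -/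
theorem jMod_eq_algebraMap_of_j_eq (j₀ : ℚ) (hj : E.j = (j₀ : F)) :
    ThetaData.jMod E = algebraMap ℚ (fieldOfModuli E) j₀ := by
  apply (algebraMap (fieldOfModuli E) F).injective
  rw [ThetaData.algebraMap_jMod, ← IsScalarTower.algebraMap_apply, hj, eq_ratCast]

include hu in
/-- `natGenerator` of the place of `ℚ` under `v = placeModOfM D u x` is `p`. [folklore] -/
theorem natGenerator_finBelow_placeModOfM (x : (thetaIndexOfInitial D).Fibre (Val.non u)) :
    Rat.HeightOneSpectrum.natGenerator (Literature.IUT.LogVolume.finBelow ℚ (fieldOfModuli E) (placeModOfM D u x)) = p := by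
  have hmem : ((p : ℕ) : 𝓞 ℚ) ∈ (Literature.IUT.LogVolume.finBelow ℚ (fieldOfModuli E) (placeModOfM D u x)).asIdeal := by
    change ((p : ℕ) : 𝓞 ℚ) ∈ Ideal.comap (algebraMap (𝓞 ℚ) (𝓞 (fieldOfModuli E))) (placeModOfM D u x).asIdeal
    rw [Ideal.mem_comap, map_natCast]
    exact natCast_mem_of_mem_placesOver p ⟨placeModOfM D u x, placeModOfM_mem_placesOver D p u hu x⟩
  exact (Nat.prime_dvd_prime_iff_eq (Rat.HeightOneSpectrum.prime_natGenerator _) hp.out).mp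
    ((UniformABCConjecture.natCast_mem_asIdeal_iff _ _).mp hmem)

include hu in
/-- `ord_{u}(p) = 1` for the place of `ℚ` under `v = placeModOfM D u x` (abc-iut-w5-d044 `Cor22.ord_natGenerator_eq_one`). [folklore] -/
theorem ord_rat_finBelow_placeModOfM_eq_one (x : (thetaIndexOfInitial D).Fibre (Val.non u)) :
    ord ℚ (Literature.IUT.LogVolume.finBelow ℚ (fieldOfModuli E) (placeModOfM D u x)) ((p : ℕ) : ℚ) = 1 := by
  have h := Cor22.ord_natGenerator_eq_one (Literature.IUT.LogVolume.finBelow ℚ (fieldOfModuli E) (placeModOfM D u x))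
  rwa [natGenerator_finBelow_placeModOfM D p u hu x] at h

/-- **Rational `j`-invariant, clean form: `‖t_{q,x}‖ = p^{ord_u(j₀)/(2l)}` at a bad member** — `ord_v(j₀) = e(v|u)·ord_u(j₀)`,
`e_v = ord_v(p) = e(v|u)·ord_u(p)` (the tree's `Cor22.ord_algebraMap_eq`, `Cor22.ord_natCast_eq_ramIdx`) and `ord_u(p) = 1`: NO ramification
index of the opaque fields remains. M-level twin of abc-iut-w4-d026's `norm_chosenQIdele_eq_rpow_ord_rat'`. [cite: NeukirchANT1999, Ch. I (8.2)]
[cite: DupuyHilado2025, §3.4] -/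
theorem norm_tqM_eq_rpow_ord_rat (x : (thetaIndexOfInitial D).Fibre (Val.non u)) (hx : placeModOfM D u x ∈ (ThetaData.pilotData D).S)
    (j₀ : ℚ) (hj : E.j = (j₀ : F)) :
    ‖tqM D p u hu r x‖ =
      (p : ℝ) ^ ((ord ℚ (Literature.IUT.LogVolume.finBelow ℚ (fieldOfModuli E) (placeModOfM D u x)) j₀ : ℝ) / (2 * l)) := by
  set v := placeModOfM D u x with hvdef
  rw [norm_tqM_eq_rpow_ord_jMod D p u hu r x hx]
  congr 1
  have h1 : ord (fieldOfModuli E) v (ThetaData.jMod E) =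
      ((Literature.IUT.LogVolume.finBelow ℚ (fieldOfModuli E) v).asIdeal.ramificationIdx' v.asIdeal : ℤ) * ord ℚ (Literature.IUT.LogVolume.finBelow ℚ (fieldOfModuli E) v) j₀ := by
    rw [jMod_eq_algebraMap_of_j_eq (E := E) j₀ hj, Cor22.ord_algebraMap_eq]
  have h2 : (ramIdx (fieldOfModuli E) v : ℤ) =
      ((Literature.IUT.LogVolume.finBelow ℚ (fieldOfModuli E) v).asIdeal.ramificationIdx' v.asIdeal : ℤ) *
        ord ℚ (Literature.IUT.LogVolume.finBelow ℚ (fieldOfModuli E) v) ((p : ℕ) : ℚ) := by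
    rw [← Cor22.ord_natCast_eq_ramIdx p v (placeModOfM_mem_placesOver D p u hu x),
      show ((p : ℕ) : fieldOfModuli E) = algebraMap ℚ (fieldOfModuli E) ((p : ℕ) : ℚ) from
        (map_natCast (algebraMap ℚ (fieldOfModuli E)) p).symm,
      Cor22.ord_algebraMap_eq]
  rw [ord_rat_finBelow_placeModOfM_eq_one D p u hu x, mul_one] at h2
  have he0 : ((Literature.IUT.LogVolume.finBelow ℚ (fieldOfModuli E) v).asIdeal.ramificationIdx' v.asIdeal : ℝ) ≠ 0 := by
    exact_mod_cast Ideal.IsDedekindDomain.ramificationIdx'_ne_zero_of_liesOver v.asIdeal (Literature.IUT.LogVolume.finBelow ℚ (fieldOfModuli E) v).ne_bot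
  have h2R : (ramIdx (fieldOfModuli E) v : ℝ) = ((Literature.IUT.LogVolume.finBelow ℚ (fieldOfModuli E) v).asIdeal.ramificationIdx' v.asIdeal : ℝ) := by
    exact_mod_cast h2
  rw [h1, h2R]
  push_cast
  rw [mul_comm ((Literature.IUT.LogVolume.finBelow ℚ (fieldOfModuli E) v).asIdeal.ramificationIdx' v.asIdeal : ℝ) (ord ℚ (Literature.IUT.LogVolume.finBelow ℚ (fieldOfModuli E) v) j₀ : ℝ),
    show (2 : ℝ) * (l : ℝ) * ((Literature.IUT.LogVolume.finBelow ℚ (fieldOfModuli E) v).asIdeal.ramificationIdx' v.asIdeal : ℝ) =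
      (2 * (l : ℝ)) * ((Literature.IUT.LogVolume.finBelow ℚ (fieldOfModuli E) v).asIdeal.ramificationIdx' v.asIdeal : ℝ) by ring,
    mul_div_mul_right _ _ he0]

/-- **Depth form: `ord_u(j₀) ≤ −h ⟹ ‖t_{q,x}‖ ≤ p^{−h/(2l)}`** at a bad member (for `λ_k = 1/2 + 2/7^k`: `p = 7`, `h = 2k`, i.e. `‖t_{q,x}‖ ≤ 7^{−k/l}`).
M-level twin of abc-iut-w4-d026's `norm_chosenQIdele_le_rpow_of_ord_le`. [cite: DupuyHilado2025, §3.4] [cite: Mochizuki2012, IUTchIV Cor. 2.2 (ii) p. 46] -/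
theorem norm_tqM_le_rpow_of_ord_le (x : (thetaIndexOfInitial D).Fibre (Val.non u)) (hx : placeModOfM D u x ∈ (ThetaData.pilotData D).S)
    (j₀ : ℚ) (hj : E.j = (j₀ : F)) (h : ℕ)
    (hord : ord ℚ (Literature.IUT.LogVolume.finBelow ℚ (fieldOfModuli E) (placeModOfM D u x)) j₀ ≤ -(h : ℤ)) :
    ‖tqM D p u hu r x‖ ≤ (p : ℝ) ^ (-(h : ℝ) / (2 * l)) := by
  have hp1 : (1 : ℝ) ≤ (p : ℝ) := by exact_mod_cast hp.out.one_lt.le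
  have hl : 0 < l := lt_of_lt_of_le (by norm_num) D.five_le_l
  rw [norm_tqM_eq_rpow_ord_rat D p u hu r x hx j₀ hj]
  refine Real.rpow_le_rpow_of_exponent_le hp1 (div_le_div_of_nonneg_right ?_ ?_)
  · exact_mod_cast hord
  · have : (0 : ℝ) < (l : ℝ) := by exact_mod_cast hl
    positivity

/-! ## §4. WHICH members are bad: (H6) at the M level, and the (H4) package at a `λ`-line point -/

/-- The place of `F_mod` under a member IS the place under (the place of `F` under) its section place `w = placeOfM D u x`. [folklore] -/
theorem placeModOfM_eq_under_finBelow (x : (thetaIndexOfInitial D).Fibre (Val.non u)) :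
    placeModOfM D u x = (Literature.IUT.LogVolume.finBelow F K (placeOfM D u x)).under (𝓞 (fieldOfModuli E)) :=
  rfl

include hu in
/-- **(H6) at the M level.** For an initial Θ-datum `D` whose `𝕍^bad_mod` is the (P5) choice ([IUTchIV] Cor. 2.2 (ii) proof p. 46), a member
`x ∈ V̲_u` over `p ≠ 2, l` with `ord j(E_F) < 0` at the place of `F` under its section place is BAD: `placeModOfM D u x ∈ S = V^bad_mod`
(abc-iut-w4-d098's `Hex.mem_pilotDataOfK_S_of_residueChar` at the section place, abc-iut-C-cert-3's `mem_pilotDataOfK_S_iff`, and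
`ThetaData.mk_mem_VFbad_iff`). [cite: Mochizuki2012, IUTchI Def. 3.1 (b) p. 61; IUTchIV Cor. 2.2 (ii) proof (P5) p. 46] -/
theorem placeModOfM_mem_S_of_ord_j_neg (hP5 : ThetaData.IsP5Choice D) (x : (thetaIndexOfInitial D).Fibre (Val.non u))
    (hp2 : p ≠ 2) (hpl : p ≠ l) (hord : ord F (Literature.IUT.LogVolume.finBelow F K (placeOfM D u x)) E.j < 0) :
    placeModOfM D u x ∈ (ThetaData.pilotData D).S := by
  have hw : placeOfM D u x ∈ (pilotDataOfK D K).S :=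
    Conditional.Hex.mem_pilotDataOfK_S_of_residueChar D hP5 K (placeOfM D u x) hp2 hpl (residueChar_placeOfM D p u hu x) hord
  have hVF := (mem_pilotDataOfK_S_iff D K (placeOfM D u x)).mp hw
  rw [ThetaData.pilotData_S, placeModOfM_eq_under_finBelow]
  exact (ThetaData.mk_mem_VFbad_iff D _).mp hVF

include hu in
/-- `natGenerator` of the place of `ℚ` under (the place of `F` under) the section place of a member is `p`. [folklore] -/
theorem natGenerator_finBelow_finBelow_placeOfM (x : (thetaIndexOfInitial D).Fibre (Val.non u)) :
    Rat.HeightOneSpectrum.natGenerator (Literature.IUT.LogVolume.finBelow ℚ F (Literature.IUT.LogVolume.finBelow F K (placeOfM D u x))) = p := by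
  have hmem : ((p : ℕ) : 𝓞 ℚ) ∈ (Literature.IUT.LogVolume.finBelow ℚ F (Literature.IUT.LogVolume.finBelow F K (placeOfM D u x))).asIdeal := by
    change ((p : ℕ) : 𝓞 ℚ) ∈
      Ideal.comap (algebraMap (𝓞 ℚ) (𝓞 F)) (Ideal.comap (algebraMap (𝓞 F) (𝓞 K)) (placeOfM D u x).asIdeal)
    rw [Ideal.mem_comap, Ideal.mem_comap, map_natCast, map_natCast]
    exact natCast_mem_placeOfM D p u hu x
  exact (Nat.prime_dvd_prime_iff_eq (Rat.HeightOneSpectrum.prime_natGenerator _) hp.out).mp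
    ((UniformABCConjecture.natCast_mem_asIdeal_iff _ _).mp hmem)

include hu in
/-- **The (H4)+(H6) package at a `λ`-line point, M level.** For an initial Θ-datum over `P = ratPoint λ` (`j(E) = j(λ)` read in `F`,
`𝕍^bad_mod` the (P5) choice) and a prime `p ≠ 2, l` at which `j(λ)` has a pole of order `≥ h ≥ 1` (for `λ_k = 1/2 + 2/7^k`: `p = 7`, `h = 2k`),
EVERY member `x` of the fibre `V̲_u` (`u ∋ p`) is BAD and the read-off q-idele there has `‖t_{q,x}‖ ≤ p^{−h/(2l)}`. M-level twin of
abc-iut-w4-d026's `norm_chosenQIdele_le_rpow_of_ratPoint'`. [cite: Mochizuki2012, IUTchIV Cor. 2.2 (ii) proof (P5) p. 46] [cite: DupuyHilado2025, §3.4] -/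
theorem placeModOfM_mem_S_and_norm_tqM_le_of_ratPoint (q : ℚ) [Algebra (ratPoint q).F F]
    (hj : E.j = algebraMap (ratPoint q).F F (Cor22.jInv (ratPoint q).x)) (hP5 : ThetaData.IsP5Choice D)
    (x : (thetaIndexOfInitial D).Fibre (Val.non u)) (h2 : p ≠ 2) (hl : p ≠ l) (h : ℕ) (hh : 1 ≤ h)
    (hord : ∀ u' : HeightOneSpectrum (𝓞 ℚ), Rat.HeightOneSpectrum.natGenerator u' = p → ord ℚ u' (Cor22.jInv q) ≤ -(h : ℤ)) :
    placeModOfM D u x ∈ (ThetaData.pilotData D).S ∧ ‖tqM D p u hu r x‖ ≤ (p : ℝ) ^ (-(h : ℝ) / (2 * l)) := by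
  have hjF : E.j = ((Cor22.jInv q : ℚ) : F) := by rw [hj]; exact eq_ratCast _ _
  -- every member is bad: `ord j(E_F) < 0` at the place of `F` under the section place, read from the pole of `j(λ)` below it
  have hordF : ord F (Literature.IUT.LogVolume.finBelow F K (placeOfM D u x)) E.j < 0 := by
    have hlt : ord ℚ (Literature.IUT.LogVolume.finBelow ℚ F (Literature.IUT.LogVolume.finBelow F K (placeOfM D u x))) (Cor22.jInv q) < 0 :=
      lt_of_le_of_lt (hord _ (natGenerator_finBelow_finBelow_placeOfM D p u hu x)) (by omega)
    rw [hjF, show ((Cor22.jInv q : ℚ) : F) = algebraMap ℚ F (Cor22.jInv q) from (eq_ratCast _ _).symm]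
    exact (Cor22.ord_algebraMap_neg_iff _ _).mpr hlt
  have hx : placeModOfM D u x ∈ (ThetaData.pilotData D).S := placeModOfM_mem_S_of_ord_j_neg D p u hu hP5 x h2 hl hordF
  exact ⟨hx, norm_tqM_le_rpow_of_ord_le D p u hu r x hx (Cor22.jInv q) hjF h
    (hord _ (natGenerator_finBelow_placeModOfM D p u hu x))⟩

end Ideles

end Summit.ABC.IUTFork.Thm311.Real

end
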